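import Literature.NumberTheory.EllipticCurves.JZeroTwoPowerTorsionKummer
import HarnessLib

/-!
# ONE Galois element with prescribed Kummer values on the `2^M`-torsion classes of TWO `j = 0` curves

Topic `NumberTheory/EllipticCurves`; namespace `Literature.NumberTheory.EllipticCurves.JZero`. THEOREMS ONLY: **no
definition and no named fact** (D-0026). The level-`2^M` form of the tree's PRIME-level
`HeegnerPointsKolyvaginPairingCMPair.exists_h1Eval_eq_pair_of_comm` (McCallum 1991 §3 (2), two curves at once), built from
`JZeroTwoPowerTorsionKummer.exists_h1Eval_eq_of_closure` (one curve, relative to `Γ_{K(B[n])}`) and the movers of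
`JZeroTwoPowerTorsionMovingElement.moving_lift`, by the commutator glue of the prime-level file: for `ρ_A ∈ Γ_A ∩ Γ_B`
and `z_A ∈ Γ_B` with `z_A - 1` bijective on `A[n]`, `c_A := z_A ρ_A z_A⁻¹ ρ_A⁻¹ ∈ Γ_A ∩ Γ_B` has `A`-values
`(z_A - 1)[x, ρ_A]` and `B`-values `0`; `ρ := c_A c_B`.
* `commutator_mem_torsionFixing_two_pow`: `g ρ g⁻¹ ρ⁻¹ ∈ Γ_{K(E[2^M])}` ((α): the action is abelian) — the `hcommN` input.
* ★ `exists_h1Eval_pair_two_pow`: for finite `T_A, T_B`, classes `h_A, h_B` and targets `u_A, u_B` killed by the respective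
  `ℤ[fn]`-annihilators modulo the spans (`huA`, `huB`), ONE `ρ ∈ Γ_{K(A[n])} ∩ Γ_{K(B[n])}` kills `T_A` and `T_B` and has
  `[h_A, ρ]_A = u_A`, `[h_B, ρ]_B = u_B`.  This is the `ρ` input of the tree's pair Čebotarev theorem
  `exists_kolyvaginPrime_gt_of_galoisElement_pair` at `p^M = 2^M`.  D440: the movers `zA`, `zB` are genuine (for `A = B`
  and `h_A = h_B`, `u_A ≠ u_B` no such `ρ` exists) — they come from the level-`2` Kummer independence of the two curves.

References: [McCallumLMS1991] W. G. McCallum, *Kolyvagin's work on Shafarevich–Tate groups* (1991), §3 (2);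
[GrossLMS1991] B. H. Gross, *Kolyvagin's work on modular elliptic curves* (1991), §9 Prop. 9.3; [Rubin1999] K. Rubin,
*Elliptic curves with complex multiplication and the conjecture of BSD*, LNM 1716 (1999), Lemma 6.3, Prop. 6.5.
-/

noncomputable section

open scoped Classical

universe u

namespace Literature.NumberTheory.EllipticCurves.JZero

open _root_.WeierstrassCurve Field CMTorsionLine

variable {K : Type u} [Field K] [CharZero K]

section Comm

variable (W : WeierstrassCurve K) [W.IsElliptic] (n : ℕ) [NeZero n] {M : ℕ}
  (fn : geomTorsion W (n : ℤ) →+ geomTorsion W (n : ℤ)) (hn : n = 2 ^ M) (hM : 1 ≤ M)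
  (hrel : ∀ Q, fn (fn Q) + fn Q + Q = 0)
  (hfn : ∀ (g : absoluteGaloisGroup K) (Q : geomTorsion W (n : ℤ)), fn (g • Q) = g • fn Q)
include hn hM hrel hfn

/-- **Commutators act trivially on `E[2^M]`**: `Γ_K` acts through the abelian `(ℤ/2^M)[fn]^×` ((α) `smul_comm`), so
`g ρ g⁻¹ ρ⁻¹ ∈ Γ_{K(E[2^M])}`. [cite: Rubin1999, Cor. 5.20] -/
theorem commutator_mem_torsionFixing_two_pow (g ρ : absoluteGaloisGroup K) :
    g * ρ * g⁻¹ * ρ⁻¹ ∈ torsionFixing W (n : ℤ) := by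
  refine (mem_torsionFixing_iff W (n : ℤ)).2 fun Q ↦ ?_
  rw [mul_smul, mul_smul, mul_smul, smul_comm_geomTorsion_two_pow W n fn hn hM hrel hfn g⁻¹ ρ⁻¹ Q, smul_inv_smul,
    smul_inv_smul]

end Comm

section Pair

variable (A B : WeierstrassCurve K) [A.IsElliptic] [B.IsElliptic] (n : ℕ) [NeZero n] {M : ℕ} (hn : n = 2 ^ M) (hM : 1 ≤ M)
  (fnA : geomTorsion A (n : ℤ) →+ geomTorsion A (n : ℤ)) (hrelA : ∀ Q, fnA (fnA Q) + fnA Q + Q = 0)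
  (hfnA : ∀ (g : absoluteGaloisGroup K) (Q : geomTorsion A (n : ℤ)), fnA (g • Q) = g • fnA Q)
  (hnofixA : ∀ Q : geomTorsion A (n : ℤ), (∀ g : absoluteGaloisGroup K, g • Q = Q) → Q = 0)
  (wHA : galH1Torsion A (n : ℤ) →+ galH1Torsion A (n : ℤ))
  (hwHA : ∀ x, ∀ ρ ∈ torsionFixing A (n : ℤ), h1Eval A (n : ℤ) (wHA x) ρ = fnA (h1Eval A (n : ℤ) x ρ))
  (fnB : geomTorsion B (n : ℤ) →+ geomTorsion B (n : ℤ)) (hrelB : ∀ Q, fnB (fnB Q) + fnB Q + Q = 0)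
  (hfnB : ∀ (g : absoluteGaloisGroup K) (Q : geomTorsion B (n : ℤ)), fnB (g • Q) = g • fnB Q)
  (hnofixB : ∀ Q : geomTorsion B (n : ℤ), (∀ g : absoluteGaloisGroup K, g • Q = Q) → Q = 0)
  (wHB : galH1Torsion B (n : ℤ) →+ galH1Torsion B (n : ℤ))
  (hwHB : ∀ y, ∀ ρ ∈ torsionFixing B (n : ℤ), h1Eval B (n : ℤ) (wHB y) ρ = fnB (h1Eval B (n : ℤ) y ρ))
include hn hM hrelA hfnA hnofixA hwHA hrelB hfnB hnofixB hwHB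

omit hnofixB hwHB in
/-- **One-sided step: prescribed `A`-values, zero `B`-values.** From `exists_h1Eval_eq_of_closure` for `A` relative to
`N := Γ_{K(B[n])}` and a mover `zA ∈ Γ_{K(B[n])}` with `zA - 1` bijective on `A[n]`: the commutator
`zA ρ zA⁻¹ ρ⁻¹ ∈ Γ_A ∩ Γ_B` kills `T_A` and every class of `B`, and takes the value `u_A` at `h_A`.
[cite: McCallumLMS1991, §3 (2)] [cite: GrossLMS1991, Prop. 9.3] -/
theorem exists_h1Eval_eq_and_forall_eq_zero_two_pow {zA : absoluteGaloisGroup K} (hzA : zA ∈ torsionFixing B (n : ℤ))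
    (hzAbij : Function.Bijective fun P : geomTorsion A (n : ℤ) ↦ zA • P - P)
    (TA : Finset (galH1Torsion A (n : ℤ))) (hA : galH1Torsion A (n : ℤ)) (uA : geomTorsion A (n : ℤ))
    (huA : ∀ a b : ℤ, a • hA + b • wHA hA ∈
      AddSubgroup.closure ((TA : Set (galH1Torsion A (n : ℤ))) ∪ wHA '' (TA : Set (galH1Torsion A (n : ℤ)))) →
      a • uA + b • fnA uA = 0) :
    ∃ ρ ∈ torsionFixing A (n : ℤ) ⊓ torsionFixing B (n : ℤ), (∀ t ∈ TA, h1Eval A (n : ℤ) t ρ = 0) ∧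
      h1Eval A (n : ℤ) hA ρ = uA ∧ ∀ y : galH1Torsion B (n : ℤ), h1Eval B (n : ℤ) y ρ = 0 := by
  -- the pre-image `P` of `uA` under `zA - 1`, still killed by the annihilator
  obtain ⟨P, hP⟩ := hzAbij.2 uA
  simp only at hP
  have hsm : ∀ (c : ℤ) (Q : geomTorsion A (n : ℤ)), zA • (c • Q) = c • (zA • Q) := fun c Q ↦
    map_zsmul (DistribSMul.toAddMonoidHom _ zA) c Q
  have huP : ∀ a b : ℤ, a • hA + b • wHA hA ∈
      AddSubgroup.closure ((TA : Set (galH1Torsion A (n : ℤ))) ∪ wHA '' (TA : Set (galH1Torsion A (n : ℤ)))) →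
      a • P + b • fnA P = 0 := by
    intro a b hab
    have h0 := huA a b hab
    rw [← hP, map_sub] at h0
    -- `(zA - 1)(a•P + b•fn P) = a•uA + b•fn uA = 0 = (zA - 1) 0`
    have key : (fun P : geomTorsion A (n : ℤ) ↦ zA • P - P) (a • P + b • fnA P) =
        (fun P : geomTorsion A (n : ℤ) ↦ zA • P - P) 0 := by
      show zA • (a • P + b • fnA P) - (a • P + b • fnA P) = zA • 0 - 0
      rw [smul_zero, sub_zero, smul_add, hsm, hsm, ← hfnA]
      have e : ∀ X Y : geomTorsion A (n : ℤ), a • X + b • Y - (a • P + b • fnA P) = a • (X - P) + b • (Y - fnA P) :=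
        fun X Y ↦ by module
      rw [e, h0]
    exact hzAbij.1 key
  obtain ⟨ρ, hρ, hT, hval⟩ := exists_h1Eval_eq_of_closure A n fnA hn hM hrelA hfnA hnofixA (torsionFixing B (n : ℤ))
    (commutator_mem_torsionFixing_two_pow B n fnB hn hM hrelB hfnB) wHA hwHA TA hA P huP
  have hconj : zA * ρ * zA⁻¹ ∈ torsionFixing A (n : ℤ) := (torsionFixing_normal A (n : ℤ)).conj_mem ρ hρ.1 zA
  have hconjB : ρ * zA⁻¹ * ρ⁻¹ ∈ torsionFixing B (n : ℤ) := (torsionFixing_normal B (n : ℤ)).conj_mem _ (Subgroup.inv_mem _ hzA) ρ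
  refine ⟨zA * ρ * zA⁻¹ * ρ⁻¹, ⟨mul_mem hconj (Subgroup.inv_mem _ hρ.1), ?_⟩, fun t ht ↦ ?_, ?_, fun y ↦ ?_⟩
  · rw [mul_assoc, mul_assoc, ← mul_assoc ρ]; exact mul_mem hzA hconjB
  · rw [h1Eval_mul A (n : ℤ) t hconj, h1Eval_conj A (n : ℤ) t zA hρ.1, h1Eval_inv A (n : ℤ) t hρ.1, hT t ht,
      smul_zero, neg_zero, add_zero]
  · rw [h1Eval_mul A (n : ℤ) hA hconj, h1Eval_conj A (n : ℤ) hA zA hρ.1, h1Eval_inv A (n : ℤ) hA hρ.1, hval, ← hP,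
      sub_eq_add_neg]
  · rw [mul_assoc, mul_assoc, ← mul_assoc ρ, h1Eval_mul B (n : ℤ) y hzA, h1Eval_conj B (n : ℤ) y ρ (Subgroup.inv_mem _ hzA),
      h1Eval_inv B (n : ℤ) y hzA, smul_neg, smul_eq_of_mem_torsionFixing B (n : ℤ) hρ.2, add_neg_cancel]

/-- ★ **ONE Galois element with prescribed values on the classes of TWO curves (level `2^M`).** For finite `T_A ⊆ H¹(K, A[n])`,
`T_B ⊆ H¹(K, B[n])`, classes `h_A, h_B` and targets `u_A ∈ A[n]`, `u_B ∈ B[n]` killed by the `ℤ[fn]`-annihilators of `h_A`,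
`h_B` modulo the spans of `T_A ∪ w T_A`, `T_B ∪ w T_B` (`huA`, `huB`), and movers `zA ∈ Γ_{K(B[n])}` (`zA - 1` bijective on
`A[n]`), `zB ∈ Γ_{K(A[n])}` (`zB - 1` bijective on `B[n]`) — `JZeroTwoPowerTorsionMovingElement.moving_lift` — there is ONE
`ρ ∈ Γ_{K(A[n])} ∩ Γ_{K(B[n])}` with `[t, ρ]_A = 0` (`t ∈ T_A`), `[h_A, ρ]_A = u_A`, `[t, ρ]_B = 0` (`t ∈ T_B`), `[h_B, ρ]_B = u_B`.
[cite: McCallumLMS1991, §3 (2)] [cite: GrossLMS1991, Prop. 9.3] [cite: Rubin1999, Lemma 6.3, Prop. 6.5] -/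
theorem exists_h1Eval_pair_two_pow {zA zB : absoluteGaloisGroup K} (hzA : zA ∈ torsionFixing B (n : ℤ))
    (hzAbij : Function.Bijective fun P : geomTorsion A (n : ℤ) ↦ zA • P - P) (hzB : zB ∈ torsionFixing A (n : ℤ))
    (hzBbij : Function.Bijective fun P : geomTorsion B (n : ℤ) ↦ zB • P - P)
    (TA : Finset (galH1Torsion A (n : ℤ))) (hA : galH1Torsion A (n : ℤ)) (uA : geomTorsion A (n : ℤ))
    (huA : ∀ a b : ℤ, a • hA + b • wHA hA ∈
      AddSubgroup.closure ((TA : Set (galH1Torsion A (n : ℤ))) ∪ wHA '' (TA : Set (galH1Torsion A (n : ℤ)))) →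
      a • uA + b • fnA uA = 0)
    (TB : Finset (galH1Torsion B (n : ℤ))) (hB : galH1Torsion B (n : ℤ)) (uB : geomTorsion B (n : ℤ))
    (huB : ∀ a b : ℤ, a • hB + b • wHB hB ∈
      AddSubgroup.closure ((TB : Set (galH1Torsion B (n : ℤ))) ∪ wHB '' (TB : Set (galH1Torsion B (n : ℤ)))) →
      a • uB + b • fnB uB = 0) :
    ∃ ρ ∈ torsionFixing A (n : ℤ) ⊓ torsionFixing B (n : ℤ),
      (∀ t ∈ TA, h1Eval A (n : ℤ) t ρ = 0) ∧ h1Eval A (n : ℤ) hA ρ = uA ∧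
      (∀ t ∈ TB, h1Eval B (n : ℤ) t ρ = 0) ∧ h1Eval B (n : ℤ) hB ρ = uB := by
  obtain ⟨cA, hcA, hTA, hvA, hzeroB⟩ := exists_h1Eval_eq_and_forall_eq_zero_two_pow A B n hn hM fnA hrelA hfnA hnofixA
    wHA hwHA fnB hrelB hfnB hzA hzAbij TA hA uA huA
  obtain ⟨cB, hcB, hTB, hvB, hzeroA⟩ := exists_h1Eval_eq_and_forall_eq_zero_two_pow B A n hn hM fnB hrelB hfnB hnofixB
    wHB hwHB fnA hrelA hfnA hzB hzBbij TB hB uB huB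
  refine ⟨cA * cB, mul_mem hcA ⟨hcB.2, hcB.1⟩, fun t ht ↦ ?_, ?_, fun t ht ↦ ?_, ?_⟩
  · rw [h1Eval_mul A (n : ℤ) t hcA.1, hTA t ht, hzeroA t, add_zero]
  · rw [h1Eval_mul A (n : ℤ) hA hcA.1, hvA, hzeroA hA, add_zero]
  · rw [h1Eval_mul B (n : ℤ) t hcA.2, hzeroB t, hTB t ht, add_zero]
  · rw [h1Eval_mul B (n : ℤ) hB hcA.2, hzeroB hB, hvB, zero_add]

end Pair

end Literature.NumberTheory.EllipticCurves.JZero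

end
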